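import Summits.QuantumFields.YangMills.Theorems.UnitScaleTiltFluctuationComparisonRegPrPrintChiLine
import Summits.QuantumFields.YangMills.Theorems.UnitScaleTiltFluctuationComparisonRegPrGlobalSlack
import Summits.QuantumFields.YangMills.Theorems.UnitScaleTiltFluctuationComparisonRegPrAlphaTwoRunAdapterT
import Summits.QuantumFields.YangMills.Theorems.UnitScaleTiltFluctuationComparisonRegPrRepAtHeightsV3Fam
import Summits.QuantumFields.YangMills.Theorems.AlphaInputsT3ACv3Data
import HarnessLib

/-!
# `UnitScaleTiltFluctuationComparisonRegPrPrintChiSlack` — STUB 4′ of crux `FluctuationComparisonRegPrL` (stmt-QuantumFields-19935), (R1) «print's χ back», part 8: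
# THE INNER PIECE IN THE LANE'S OWN CURRENCY (King's slack row 3⁗ READ ON THE DOUBLY-χ-GOOD DATA), its S-E″ counting, and the sockets into 4′ (RULING g21-№4 §A)

Cell `ym3-torus`, width-lever lane `ym-ust-19935-r1`; parts 1–7 = p528527, p529532, p529535, p530007, p530363, p531138, p531988.  Count-neutral helper.  Nothing of
[Balaban1985UV3]/[King1986] is asserted; §2 is p523985's `GlobalSlack` counting with the window bound asserted and concluded on a sub-predicate (helpers reused by name).
* §1 `GlobalSupRateTSlackOn S D …` — the registered 3⁗ row `GlobalSlack.GlobalSupRateTSlack` asserted only at doubly-`S`-good data; `globalSupRateTSlackOn_of_slack`.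
* §2 `summable_slackRadii`, `pintCauchyOn_of_globalSupRateTSlackOn(_seven)` (= (b1) of RULING g21-№4 §A), `levelCauchyOnOfGlobalSupRateTSlackOn_dec` (registered quantifier shape).
* §3 `stub_logComparisonSmallBlocks_of_laneRecords_slackOnChi_edge` — 4′ VERBATIM ⇐ (2′ verbatim) ∧ (3⁗χ at a margin function `μ L`: the registered 3⁗ text with `7 ≤ L ↦ L < 7` and
  its row ↦ `GlobalSupRateTSlackOn χ_{ε₀, μ L}` for every `0 < ε₀ ≤ a₀`) ∧ (edge off χ at `μ L`); (A) by the landed `repAtHeights_dataOfV3` at every block size, thresholds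
  `exists_gamma_thresholds`, χ-S-E″, socket `stubBodyOn_of_repOn_of_cauchyOn`, glue `stub_logComparisonSmallBlocks_of_chi_edge`.
* §4 `fourPrime_of_slackOnChi_edge` — THE OWNER'S SOCKET (b2) in the SANCTIONED shapes: (i)* `∀ μ ∈ (0,1)` [K1a-on-χ] → (ii)* `∃ μ ∈ (0,1)` [edge off χ] → 4′ VERBATIM.
So at `L ∈ {3,5}`: 4′ = «3⁗ on χ» + «edge off χ», the first in the (α) lane's currency with no block-size floor and no representation asked on the edge band.

References: C. King, CMP 102 (1986) 649–677 [King1986] (Thm 3.4 (3.9) p.656, (3.12)–(3.13) p.657); T. Bałaban, CMP 102 (1985) 255–275 [Balaban1985UV3] ((47) p.267, (57) p.270).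
-/

noncomputable section

namespace Summit.QuantumFields.YangMills.Theorems.PrintChi

open MeasureTheory Filter
open Literature.MathematicalPhysics.QuantumFieldTheory.Balaban1983to89
open Literature.MathematicalPhysics.QuantumFieldTheory.Balaban1983to89.T3ContinuumYM3Torus
open Literature.MathematicalPhysics.QuantumFieldTheory.Balaban1983to89.T3UnitLawDensityEML (ℰp measurableE_ℰp)
open Literature.MathematicalPhysics.QuantumFieldTheory.Balaban1983to89.T3UnitScaleTilt
open Literature.MathematicalPhysics.QuantumFieldTheory.Balaban1983to89.T3TiltDescent
open Literature.MathematicalPhysics.QuantumFieldTheory.Balaban1983to89.T3PrintedRegularMinimiser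
open Literature.MathematicalPhysics.QuantumFieldTheory.Balaban1983to89.T3LogComparisonSocket
open Literature.MathematicalPhysics.QuantumFieldTheory.Balaban1983to89.T3AlphaInputsAC
open Summit.QuantumFields.YangMills.Theorems.LogComparisonPolymerBudget
open Summit.QuantumFields.YangMills.Theorems.GlobalSlack

/-! ## §1 The slack row on a sub-predicate -/

section SlackOn

variable {F : T3Family} {γ : ℝ} (S : (K n : ℕ) → n ≤ K → GaugeField (F.P n) 0 (Matrix.specialUnitaryGroup (Fin 2) ℂ) → Prop) (D : AlphaDataT3 F γ)

/-- **KING'S SLACK ROW ON A SUB-PREDICATE** (hypothesis schema, never asserted): the registered 3⁗ row `GlobalSlack.GlobalSupRateTSlack` — on the `θ(n)`-window at every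
co-height `n ≤ K`, `|PintH (K+1) n V − PintH K n V − c K n| ≤ C·#Site(F.P n)·(θ(n)²·L^{−a(K−n)} + θ(n)^σ)` with datum-independent shifts — asserted only at data `V` that are
`S`-good for BOTH runs (`S K n _ V ∧ S (K+1) n _ V`; to be the doubly-χ-good data of `…PrintChi`). [cite: King1986, Thm 3.4 (3.9) p.656] -/
def GlobalSupRateTSlackOn (b₀ p₀ a : ℝ) (σ : ℕ) (C : ℝ) : Prop :=
  ∃ c : ℕ → ℕ → ℝ, ∀ (K n : ℕ) (h : n ≤ K) (V : GaugeField (F.P n) 0 (Matrix.specialUnitaryGroup (Fin 2) ℂ)), PlaqSmall (θBal F.L γ b₀ p₀ n) V →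
    S K n h V → S (K + 1) n (h.trans (Nat.le_succ K)) V →
    |D.PintH (K + 1) n V - D.PintH K n V - c K n| ≤
      C * (Fintype.card (Site (F.P n) 0) : ℝ) * (θBal F.L γ b₀ p₀ n ^ 2 * (((F.L : ℝ) ^ (K - n))⁻¹) ^ a + θBal F.L γ b₀ p₀ n ^ σ)

variable {S D}

/-- The full-window row implies the restricted one for every `S`. [cite: King1986, Thm 3.4 (3.9) p.656] -/
theorem globalSupRateTSlackOn_of_slack {b₀ p₀ a : ℝ} {σ : ℕ} {C : ℝ} (h : GlobalSupRateTSlack D b₀ p₀ a σ C) :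
    GlobalSupRateTSlackOn S D b₀ p₀ a σ C := by
  obtain ⟨c, hc⟩ := h
  exact ⟨c, fun K n h V hV _ _ => hc K n h V hV⟩

end SlackOn

/-! ## §2 The χ-restricted S-E″ (pure counting) -/

section Counting

variable {F : T3Family} {γ : ℝ}

/-- **THE SLACK RADII ARE SUMMABLE ALONG THE FREE FRACTION** (the counting of `GlobalSlack.cauchyAtHeights_of_globalSupRateTSlack`, stated once): for `1 < L`, `0 < γ ≤ 1`,
`0 < b₀`, `0 < p₀`, `0 < a`, `0 ≤ C`, `m > (3+a)/a`, a geometric profile `θ(n) ≤ C_θρⁿ` with `ρ^σL³ < 1`: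
`Σ_K C·#Site(F.P ⌊K/m⌋)·(θ(⌊K/m⌋)²·L^{−a(K−⌊K/m⌋)} + θ(⌊K/m⌋)^σ) < ∞`. [cite: King1986, (3.12)-(3.13) p.657] -/
theorem summable_slackRadii {b₀ p₀ a C Cθ ρ : ℝ} {σ m : ℕ}
    (hL : 1 < F.L) (hγ : 0 < γ) (hγ1 : γ ≤ 1) (hb : 0 < b₀) (hp : 0 < p₀) (ha : 0 < a) (hC : 0 ≤ C)
    (hm : (3 + a) / a < (m : ℝ))
    (hρ : 0 ≤ ρ) (hθρ : ∀ n, θBal F.L γ b₀ p₀ n ≤ Cθ * ρ ^ n) (hρσ : ρ ^ σ * (F.L : ℝ) ^ 3 < 1) :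
    (∀ K, 0 ≤ C * (Fintype.card (Site (F.P (K / m)) 0) : ℝ) *
        (θBal F.L γ b₀ p₀ (K / m) ^ 2 * (((F.L : ℝ) ^ (K - K / m))⁻¹) ^ a + θBal F.L γ b₀ p₀ (K / m) ^ σ)) ∧
    Summable fun K : ℕ => C * (Fintype.card (Site (F.P (K / m)) 0) : ℝ) *
        (θBal F.L γ b₀ p₀ (K / m) ^ 2 * (((F.L : ℝ) ^ (K - K / m))⁻¹) ^ a + θBal F.L γ b₀ p₀ (K / m) ^ σ) := by
  classical
  have hLr : (1 : ℝ) < (F.L : ℝ) := by exact_mod_cast hL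
  have hL0 : (0 : ℝ) < (F.L : ℝ) := by linarith
  have hm0r : (0 : ℝ) < m := lt_trans (by positivity) hm
  have hm0 : 0 < m := by exact_mod_cast hm0r
  have hc0 : 0 < a - (3 + a) / m := by
    have : (3 + a) / (m : ℝ) < a := by
      rw [div_lt_iff₀ hm0r]
      have := (div_lt_iff₀ ha).mp hm
      linarith
    linarith
  obtain ⟨hr0, hr1⟩ := rpow_neg_lt_one hLr hc0
  obtain ⟨Θ, hΘdef⟩ : ∃ Θ : ℝ, Θ = b₀ * ((2 * p₀) ^ p₀ * Real.exp (1 / 2 - p₀)) * Real.sqrt (Real.sqrt γ) := ⟨_, rfl⟩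
  have hθΘ : ∀ i, θBal F.L γ b₀ p₀ i ≤ Θ := fun i => by
    rw [hΘdef]; exact T3Thresholds.θBal_le_const_mul_rpow hL.le hγ hγ1 hb.le hp i
  have hθ0 : ∀ i, 0 < θBal F.L γ b₀ p₀ i := T3MinimiserStabilityReduction.θBal_pos hL.le hγ hγ1 hb p₀
  have hCθ : 0 ≤ Cθ := by
    have h := (hθ0 0).le.trans (hθρ 0)
    simpa using h
  obtain ⟨q, hqdef⟩ : ∃ q : ℝ, q = ρ ^ σ * (F.L : ℝ) ^ 3 := ⟨_, rfl⟩
  have hq0 : 0 ≤ q := by rw [hqdef]; positivity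
  obtain ⟨q₁, hq₁def⟩ : ∃ q₁ : ℝ, q₁ = max q (1 / 2) := ⟨_, rfl⟩
  have hq₁0 : 0 < q₁ := by rw [hq₁def]; exact lt_of_lt_of_le (by norm_num) (le_max_right _ _)
  have hq₁1 : q₁ < 1 := by rw [hq₁def, hqdef]; exact max_lt hρσ (by norm_num)
  have hqq₁ : q ≤ q₁ := by rw [hq₁def]; exact le_max_left _ _
  obtain ⟨r₁, hr₁def⟩ : ∃ r₁ : ℝ, r₁ = (F.L : ℝ) ^ (-(a - (3 + a) / m)) := ⟨_, rfl⟩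
  obtain ⟨r₂, hr₂def⟩ : ∃ r₂ : ℝ, r₂ = q₁ ^ (1 / (m : ℝ)) := ⟨_, rfl⟩
  have hr₂0 : 0 ≤ r₂ := by rw [hr₂def]; positivity
  have hr₂1 : r₂ < 1 := by rw [hr₂def]; exact Real.rpow_lt_one hq₁0.le hq₁1 (by positivity)
  obtain ⟨A, hAdef⟩ : ∃ A : ℝ, A = C * 8 * (F.L : ℝ) ^ (3 * F.m) * Θ ^ 2 := ⟨_, rfl⟩
  obtain ⟨B, hBdef⟩ : ∃ B : ℝ, B = C * 8 * (F.L : ℝ) ^ (3 * F.m) * Cθ ^ σ * q₁⁻¹ := ⟨_, rfl⟩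
  have hnn : ∀ K, 0 ≤ C * (Fintype.card (Site (F.P (K / m)) 0) : ℝ) *
      (θBal F.L γ b₀ p₀ (K / m) ^ 2 * (((F.L : ℝ) ^ (K - K / m))⁻¹) ^ a + θBal F.L γ b₀ p₀ (K / m) ^ σ) := fun K =>
    mul_nonneg (mul_nonneg hC (Nat.cast_nonneg _))
      (add_nonneg (mul_nonneg (pow_nonneg (hθ0 _).le 2) (Real.rpow_nonneg (inv_nonneg.mpr (pow_nonneg hL0.le _)) a))
        (pow_nonneg (hθ0 _).le σ))
  refine ⟨hnn, ?_⟩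
  have hmaj : Summable fun K : ℕ => A * r₁ ^ K + B * r₂ ^ K := by
    rw [hr₁def]
    exact ((summable_geometric_of_lt_one hr0.le hr1).mul_left A).add ((summable_geometric_of_lt_one hr₂0 hr₂1).mul_left B)
  refine hmaj.of_nonneg_of_le hnn fun K => ?_
  rw [card_site_zero]
  have h1 : C * (8 * (F.L : ℝ) ^ (3 * (F.m + K / m))) * (θBal F.L γ b₀ p₀ (K / m) ^ 2 * (((F.L : ℝ) ^ (K - K / m))⁻¹) ^ a) ≤
      A * r₁ ^ K := by
    have hθ2 : θBal F.L γ b₀ p₀ (K / m) ^ 2 ≤ Θ ^ 2 := pow_le_pow_left₀ (hθ0 _).le (hθΘ _) 2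
    have hpow : (F.L : ℝ) ^ (3 * (F.m + K / m)) * (((F.L : ℝ) ^ (K - K / m))⁻¹) ^ a =
        (F.L : ℝ) ^ (3 * F.m) * (F.L : ℝ) ^ ((3 * (K / m : ℕ) - a * (K - K / m : ℕ) : ℝ)) := by
      rw [inv_pow_rpow_eq_rpow hL0, mul_add, pow_add, ← Real.rpow_natCast (F.L : ℝ) (3 * (K / m)), mul_assoc, ← Real.rpow_add hL0]
      congr 2
      push_cast
      ring
    have hff : (F.L : ℝ) ^ ((3 * (K / m : ℕ) - a * (K - K / m : ℕ) : ℝ)) ≤ r₁ ^ K := by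
      rw [hr₁def]; exact rpow_free_fraction_le hLr ha.le hm0 K
    have hXnn : 0 ≤ (F.L : ℝ) ^ ((3 * (K / m : ℕ) - a * (K - K / m : ℕ) : ℝ)) := Real.rpow_nonneg hL0.le _
    calc C * (8 * (F.L : ℝ) ^ (3 * (F.m + K / m))) * (θBal F.L γ b₀ p₀ (K / m) ^ 2 * (((F.L : ℝ) ^ (K - K / m))⁻¹) ^ a)
        = C * 8 * θBal F.L γ b₀ p₀ (K / m) ^ 2 * ((F.L : ℝ) ^ (3 * (F.m + K / m)) * (((F.L : ℝ) ^ (K - K / m))⁻¹) ^ a) := by ring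
      _ = C * 8 * θBal F.L γ b₀ p₀ (K / m) ^ 2 * ((F.L : ℝ) ^ (3 * F.m) * (F.L : ℝ) ^ ((3 * (K / m : ℕ) - a * (K - K / m : ℕ) : ℝ))) := by
          rw [hpow]
      _ ≤ C * 8 * Θ ^ 2 * ((F.L : ℝ) ^ (3 * F.m) * r₁ ^ K) :=
          mul_le_mul (mul_le_mul_of_nonneg_left hθ2 (by positivity)) (mul_le_mul_of_nonneg_left hff (by positivity))
            (mul_nonneg (by positivity) hXnn) (by positivity)
      _ = A * r₁ ^ K := by rw [hAdef]; ring
  have h2 : C * (8 * (F.L : ℝ) ^ (3 * (F.m + K / m))) * θBal F.L γ b₀ p₀ (K / m) ^ σ ≤ B * r₂ ^ K := by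
    have hθσ : θBal F.L γ b₀ p₀ (K / m) ^ σ ≤ Cθ ^ σ * (ρ ^ σ) ^ (K / m) := by
      calc θBal F.L γ b₀ p₀ (K / m) ^ σ ≤ (Cθ * ρ ^ (K / m)) ^ σ := pow_le_pow_left₀ (hθ0 _).le (hθρ _) σ
        _ = Cθ ^ σ * (ρ ^ σ) ^ (K / m) := by rw [mul_pow, ← pow_mul, ← pow_mul, mul_comm (K / m) σ]
    have hL3 : (F.L : ℝ) ^ (3 * (F.m + K / m)) = (F.L : ℝ) ^ (3 * F.m) * ((F.L : ℝ) ^ 3) ^ (K / m) := by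
      rw [← pow_mul, ← pow_add, ← mul_add]
    have hqK : (ρ ^ σ) ^ (K / m) * ((F.L : ℝ) ^ 3) ^ (K / m) = q ^ (K / m) := by rw [hqdef, mul_pow]
    have hq₁K : q ^ (K / m) ≤ q₁ ^ (K / m) := pow_le_pow_left₀ hq0 hqq₁ _
    have hgeom : q₁ ^ (K / m) ≤ q₁⁻¹ * r₂ ^ K := by rw [hr₂def]; exact pow_div_le_geom hq₁0 hq₁1.le hm0 K
    calc C * (8 * (F.L : ℝ) ^ (3 * (F.m + K / m))) * θBal F.L γ b₀ p₀ (K / m) ^ σ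
        ≤ C * (8 * (F.L : ℝ) ^ (3 * (F.m + K / m))) * (Cθ ^ σ * (ρ ^ σ) ^ (K / m)) :=
          mul_le_mul_of_nonneg_left hθσ (by positivity)
      _ = C * 8 * (F.L : ℝ) ^ (3 * F.m) * Cθ ^ σ * ((ρ ^ σ) ^ (K / m) * ((F.L : ℝ) ^ 3) ^ (K / m)) := by rw [hL3]; ring
      _ = C * 8 * (F.L : ℝ) ^ (3 * F.m) * Cθ ^ σ * q ^ (K / m) := by rw [hqK]
      _ ≤ C * 8 * (F.L : ℝ) ^ (3 * F.m) * Cθ ^ σ * (q₁⁻¹ * r₂ ^ K) :=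
          mul_le_mul_of_nonneg_left (hq₁K.trans hgeom) (by positivity)
      _ = B * r₂ ^ K := by rw [hBdef]; ring
  calc C * (8 * (F.L : ℝ) ^ (3 * (F.m + K / m))) *
        (θBal F.L γ b₀ p₀ (K / m) ^ 2 * (((F.L : ℝ) ^ (K - K / m))⁻¹) ^ a + θBal F.L γ b₀ p₀ (K / m) ^ σ)
      = C * (8 * (F.L : ℝ) ^ (3 * (F.m + K / m))) * (θBal F.L γ b₀ p₀ (K / m) ^ 2 * (((F.L : ℝ) ^ (K - K / m))⁻¹) ^ a) +
        C * (8 * (F.L : ℝ) ^ (3 * (F.m + K / m))) * θBal F.L γ b₀ p₀ (K / m) ^ σ := by ring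
    _ ≤ A * r₁ ^ K + B * r₂ ^ K := add_le_add h1 h2

/-- **THE χ-RESTRICTED S-E″**: `GlobalSupRateTSlackOn S D b₀ p₀ a σ C` ⇒ `PintCauchyOn S m D.PintH` under the counting conditions of `GlobalSlack.cauchyAtHeights_of_globalSupRateTSlack`
(geometric profile with `ρ^σL³ < 1`, `m > (3+a)/a`) — the bound is asserted and concluded on the doubly-`S`-good data only. [cite: King1986, Thm 3.4 (3.9) p.656] -/
theorem pintCauchyOn_of_globalSupRateTSlackOn
    (S : (K n : ℕ) → n ≤ K → GaugeField (F.P n) 0 (Matrix.specialUnitaryGroup (Fin 2) ℂ) → Prop) (D : AlphaDataT3 F γ)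
    {b₀ p₀ a C Cθ ρ : ℝ} {σ m : ℕ}
    (hL : 1 < F.L) (hγ : 0 < γ) (hγ1 : γ ≤ 1) (hb : 0 < b₀) (hp : 0 < p₀) (ha : 0 < a) (hC : 0 ≤ C)
    (hm : (3 + a) / a < (m : ℝ))
    (hρ : 0 ≤ ρ) (hθρ : ∀ n, θBal F.L γ b₀ p₀ n ≤ Cθ * ρ ^ n) (hρσ : ρ ^ σ * (F.L : ℝ) ^ 3 < 1)
    (h : GlobalSupRateTSlackOn S D b₀ p₀ a σ C) :
    PintCauchyOn F γ b₀ p₀ S m D.PintH := by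
  obtain ⟨c, hc⟩ := h
  obtain ⟨hnn, hsum⟩ := summable_slackRadii (F := F) hL hγ hγ1 hb hp ha hC hm hρ hθρ hρσ (σ := σ)
  exact ⟨_, fun K => c K (K / m), hsum, hnn, fun K => ae_of_all _ fun V hV hS hS' _ _ =>
    hc K (K / m) (Nat.div_le_self K m) V hV hS hS'⟩

/-- **THE χ-RESTRICTED S-E″, SHARP PROFILE, `σ ≥ 7`** (`c = 1/8`: `ρ = L^{−7/16}`, `ρ⁷L³ = L^{−1/16} < 1`). [cite: King1986, Thm 3.4 (3.9) p.656] -/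
theorem pintCauchyOn_of_globalSupRateTSlackOn_seven
    (S : (K n : ℕ) → n ≤ K → GaugeField (F.P n) 0 (Matrix.specialUnitaryGroup (Fin 2) ℂ) → Prop) (D : AlphaDataT3 F γ)
    {b₀ p₀ a C : ℝ} {σ m : ℕ}
    (hL : 1 < F.L) (hγ : 0 < γ) (hγ1 : γ ≤ 1) (hb : 0 < b₀) (hp : 0 < p₀) (ha : 0 < a) (hC : 0 ≤ C)
    (hm : (3 + a) / a < (m : ℝ)) (hσ : 7 ≤ σ) (h : GlobalSupRateTSlackOn S D b₀ p₀ a σ C) :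
    PintCauchyOn F γ b₀ p₀ S m D.PintH := by
  have hc : (0 : ℝ) < 1 / 8 := by norm_num
  have hσr : (7 : ℝ) ≤ σ := by exact_mod_cast hσ
  refine pintCauchyOn_of_globalSupRateTSlackOn S D hL hγ hγ1 hb hp ha hC hm (ρ := ((F.L : ℝ)⁻¹) ^ ((1 - 1 / 8 : ℝ) / 2))
    (Cθ := b₀ * ((p₀ / (1 / 8)) ^ p₀ * Real.exp (1 / 8 - p₀)) * γ ^ ((1 - 1 / 8 : ℝ) / 2))
    (by positivity) (fun n => θBal_le_geometric_sharp hL.le hγ hγ1 hb.le hp hc n) ?_ h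
  exact slack_ratio_lt_one hL (by nlinarith)

/-- **THE χ-RESTRICTED S-E″ SLOT IN THE REGISTERED QUANTIFIER SHAPE** (`ε₁ = γ₁ = 1`, `m₀ = ⌈(3+a)/a⌉ + 1`): for every `S`, `GlobalSupRateTSlackOn S D b₀ p₀ a σ C` with `σ ≥ 7`,
`C ≥ 0` gives `PintCauchyOn S m D.PintH`. [cite: King1986, Thm 3.4 (3.9) p.656] -/
theorem levelCauchyOnOfGlobalSupRateTSlackOn_dec :
    ∀ (L : ℕ), Odd L → 1 < L → ∀ (a : ℝ), 0 < a →
      ∃ ε₁ : ℝ, 0 < ε₁ ∧ ∀ (ε₀ : ℝ), 0 < ε₀ → ε₀ ≤ ε₁ → ∃ m₀ : ℕ, ∀ (m : ℕ), m₀ ≤ m → ∀ (b₀ p₀ : ℝ), 0 < b₀ → 2 < p₀ →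
        ∃ γ₁ : ℝ, 0 < γ₁ ∧ ∀ (F : T3Family) (γ : ℝ), F.L = L → 0 < γ → γ ≤ γ₁ →
          ∀ (S : (K n : ℕ) → n ≤ K → GaugeField (F.P n) 0 (Matrix.specialUnitaryGroup (Fin 2) ℂ) → Prop)
            (D : AlphaDataT3 F γ) (σ : ℕ) (C : ℝ), 7 ≤ σ → 0 ≤ C → GlobalSupRateTSlackOn S D b₀ p₀ a σ C → PintCauchyOn F γ b₀ p₀ S m D.PintH := by
  intro L _ hL a ha
  refine ⟨1, one_pos, fun ε₀ _ _ => ⟨Nat.ceil ((3 + a) / a) + 1, fun m hm b₀ p₀ hb hp => ?_⟩⟩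
  refine ⟨1, one_pos, fun F γ hF hγ hγ1 S D σ C hσ hC h => ?_⟩
  have hL' : 1 < F.L := by rw [hF]; exact hL
  exact pintCauchyOn_of_globalSupRateTSlackOn_seven S D hL' hγ hγ1 hb (by linarith) ha hC (lt_of_ceil_succ_le hm) hσ h

end Counting

/-! ## §3 The composition: 2′ ∧ 3⁗-on-χ (odd `L < 7`) ∧ edge-off-χ ⟹ 4′ verbatim -/

section Composition

/-- **STUB 4′ FROM THE LANE RECORDS, KING'S SLACK ROW READ ON χ-GOOD DATA, AND THE EDGE CLAUSE** (margin function `μ L` fixed in advance).  (2′) the registered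
lane-records stub verbatim; (3⁗χ) the registered 3⁗ text with `7 ≤ L ↦ L < 7` and its row ↦ `GlobalSupRateTSlackOn χ_{ε₀, μ L} (dataOfV3 p π) …` for every `0 < ε₀ ≤ a₀`
(`p, π, σ, C` chosen before `ε₀`, as in 3⁗); (4′b) the edge-oscillation clause off the doubly-χ-good set.  Conclusion: THE REGISTERED 4′ TEXT — (A) by the landed
`repAtHeights_dataOfV3` (every block size) weakened to `TwoSidedRepOn χ`, thresholds `exists_gamma_thresholds`, §2's χ-S-E″, `stubBodyOn_of_repOn_of_cauchyOn`,
`stub_logComparisonSmallBlocks_of_chi_edge`. [cite: King1986, Thm 3.4 (3.9) p.656; Balaban1985UV3, (47) p.267] -/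
theorem stub_logComparisonSmallBlocks_of_laneRecords_slackOnChi_edge (μ : ℕ → ℝ)
    (h2 : ∀ L : ℕ, Odd L → 1 < L → Summit.QuantumFields.YangMills.Theorems.AlphaInputsT3ACv3Rec L)
    (h3χ : ∀ (L : ℕ), Odd L → 1 < L → L < 7 →
      ∀ (𝔠 : Summit.QuantumFields.Balaban3D.Proofs.Primitives.AlphaConsts L (Summit.QuantumFields.Balaban3D.Carriers.suGroupModel 2).N)
        (a₀ a₁ : ℝ), 0 < a₀ → 0 < a₁ → 𝔠.B₃ * a₁ ≤ a₀ →
        ∃ a : ℝ, 0 < a ∧ ∃ γB : ℝ, 0 < γB ∧ ∀ (F : T3Family) (γ : ℝ) (hF : F.L = L) (hγ : 0 < γ), γ ≤ γB →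
          ∀ (hγ1 : γ ≤ (min (hF ▸ 𝔠).gamma0 1) ^ 2),
            Summit.QuantumFields.YangMills.Theorems.AlphaInputsT3AC.OfV3At F (hF ▸ 𝔠) a₀ a₁ →
            ∃ (p : ∀ K, Summit.QuantumFields.YangMills.Theorems.AlphaInputsT3AC.PkgAtV3 F (hF ▸ 𝔠) γ hγ hγ1 K),
              (∀ K, (p K).a₀ = a₀ ∧ (p K).a₁ = a₁) ∧
              ∃ (π : Summit.QuantumFields.YangMills.Theorems.AlphaInputsT3AC.PolymerT3 F) (σ : ℕ) (C : ℝ), 7 ≤ σ ∧ 0 ≤ C ∧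
                ∀ ε₀ : ℝ, 0 < ε₀ → ε₀ ≤ a₀ →
                  GlobalSupRateTSlackOn (fun K n h V => ChiGood F γ (hF ▸ 𝔠).b₀ (hF ▸ 𝔠).p₀ ε₀ (μ L) (n := n) (K := K) h V)
                    (Summit.QuantumFields.YangMills.Theorems.AlphaInputsT3AC.dataOfV3 p π) (hF ▸ 𝔠).b₀ (hF ▸ 𝔠).p₀ a σ C)
    (hEdge : ∀ (L : ℕ), Odd L → 1 < L → L < 7 → ∃ (b₁ p₁ : ℝ), ∀ (b₀ p₀ : ℝ), b₁ ≤ b₀ → p₁ ≤ p₀ → 0 < b₀ → 2 < p₀ →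
      ∃ ε₁ : ℝ, 0 < ε₁ ∧ ∀ (ε₀ : ℝ), 0 < ε₀ → ε₀ ≤ ε₁ → ∃ m₀ : ℕ, ∀ (m : ℕ), m₀ ≤ m →
        ∃ γ₁ : ℝ, 0 < γ₁ ∧ ∀ (F : T3Family) (γ : ℝ), F.L = L → 0 < γ → γ ≤ γ₁ →
          ∃ r' : ℕ → ℝ, Summable r' ∧ (∀ K, 0 ≤ r' K) ∧ ∀ K, ∃ c : ℝ,
            (∀ᵐ V ∂fieldMeasure (F.P (K / m)) 0 (Matrix.specialUnitaryGroup (Fin 2) ℂ),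
              PlaqSmall (θBal F.L γ b₀ p₀ (K / m)) V →
                ¬ (ChiGood F γ b₀ p₀ ε₀ (μ L) (Nat.div_le_self K m) V ∧
                    ChiGood F γ b₀ p₀ ε₀ (μ L) ((Nat.div_le_self K m).trans (Nat.le_succ K)) V) →
                0 < heightDensity F γ (Nat.div_le_self K m) (histGood F ℰp (θBal F.L γ b₀ p₀) K (K / m)) V →
                0 < heightDensity F γ ((Nat.div_le_self K m).trans (Nat.le_succ K))
                      (histGood F ℰp (θBal F.L γ b₀ p₀) (K + 1) (K / m)) V →
                  |(Real.log (heightDensity F γ ((Nat.div_le_self K m).trans (Nat.le_succ K))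
                        (histGood F ℰp (θBal F.L γ b₀ p₀) (K + 1) (K / m)) V) + bgRegPr' F γ m ε₀ K V) -
                    (Real.log (heightDensity F γ (Nat.div_le_self K m) (histGood F ℰp (θBal F.L γ b₀ p₀) K (K / m)) V) + bgRegPr F γ m ε₀ K V) -
                      c| ≤ r' K) ∧
            (∃ᵐ V ∂fieldMeasure (F.P (K / m)) 0 (Matrix.specialUnitaryGroup (Fin 2) ℂ),
              (PlaqSmall (θBal F.L γ b₀ p₀ (K / m)) V ∧
                ChiGood F γ b₀ p₀ ε₀ (μ L) (Nat.div_le_self K m) V ∧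
                ChiGood F γ b₀ p₀ ε₀ (μ L) ((Nat.div_le_self K m).trans (Nat.le_succ K)) V) ∧
                0 < heightDensity F γ (Nat.div_le_self K m) (histGood F ℰp (θBal F.L γ b₀ p₀) K (K / m)) V ∧
                0 < heightDensity F γ ((Nat.div_le_self K m).trans (Nat.le_succ K))
                      (histGood F ℰp (θBal F.L γ b₀ p₀) (K + 1) (K / m)) V ∧
                  |(Real.log (heightDensity F γ ((Nat.div_le_self K m).trans (Nat.le_succ K))
                        (histGood F ℰp (θBal F.L γ b₀ p₀) (K + 1) (K / m)) V) + bgRegPr' F γ m ε₀ K V) -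
                    (Real.log (heightDensity F γ (Nat.div_le_self K m) (histGood F ℰp (θBal F.L γ b₀ p₀) K (K / m)) V) + bgRegPr F γ m ε₀ K V) -
                      c| ≤ r' K)) :
    ∀ (L : ℕ), Odd L → 1 < L → L < 7 → ∃ (b₁ p₁ : ℝ), ∀ (b₀ p₀ : ℝ), b₁ ≤ b₀ → p₁ ≤ p₀ → 0 < b₀ → 2 < p₀ →
      ∃ ε₁ : ℝ, 0 < ε₁ ∧ ∀ (ε₀ : ℝ), 0 < ε₀ → ε₀ ≤ ε₁ → ∃ m₀ : ℕ, ∀ (m : ℕ), m₀ ≤ m →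
        ∃ γ₁ : ℝ, 0 < γ₁ ∧ ∀ (F : T3Family) (γ : ℝ), F.L = L → 0 < γ → γ ≤ γ₁ →
          ∃ (r κ : ℕ → ℝ), Summable r ∧ (∀ K, 0 ≤ r K) ∧
            ∀ K, ∀ᵐ V ∂fieldMeasure (F.P (K / m)) 0 (Matrix.specialUnitaryGroup (Fin 2) ℂ),
              PlaqSmall (θBal F.L γ b₀ p₀ (K / m)) V →
                0 < heightDensity F γ (Nat.div_le_self K m) (histGood F ℰp (θBal F.L γ b₀ p₀) K (K / m)) V →
                0 < heightDensity F γ ((Nat.div_le_self K m).trans (Nat.le_succ K))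
                      (histGood F ℰp (θBal F.L γ b₀ p₀) (K + 1) (K / m)) V →
                  |(Real.log (heightDensity F γ ((Nat.div_le_self K m).trans (Nat.le_succ K))
                        (histGood F ℰp (θBal F.L γ b₀ p₀) (K + 1) (K / m)) V) + bgRegPr' F γ m ε₀ K V) -
                    (Real.log (heightDensity F γ (Nat.div_le_self K m) (histGood F ℰp (θBal F.L γ b₀ p₀) K (K / m)) V) + bgRegPr F γ m ε₀ K V) -
                      κ K| ≤ r K := by
  refine stub_logComparisonSmallBlocks_of_chi_edge μ (fun L hLo hL hL7 => ?_) hEdge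
  obtain ⟨b₁, p₁, hrec⟩ := h2 L hLo hL
  refine ⟨b₁, p₁, fun b₀ p₀ hb1 hp1 hb hp => ?_⟩
  obtain ⟨𝔠, a₀, a₁, hcb, hcp, ha0, ha1, hw, h𝔠⟩ := hrec b₀ p₀ hb1 hp1
  subst hcb
  subst hcp
  obtain ⟨a, ha, γB, hγB, hBC⟩ := h3χ L hLo hL hL7 𝔠 a₀ a₁ ha0 ha1 hw
  obtain ⟨εs, hεs, hS⟩ := levelCauchyOnOfGlobalSupRateTSlackOn_dec L hLo hL a ha
  refine ⟨min a₀ εs, lt_min ha0 hεs, fun ε₀ h0 h1 => ?_⟩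
  have h1a : ε₀ ≤ a₀ := h1.trans (min_le_left _ _)
  have h1s : ε₀ ≤ εs := h1.trans (min_le_right _ _)
  obtain ⟨m₀, hm₀⟩ := hS ε₀ h0 h1s
  refine ⟨max m₀ 1, fun m hm => ?_⟩
  have hmpos : 0 < m := Nat.lt_of_lt_of_le Nat.one_pos ((le_max_right _ _).trans hm)
  obtain ⟨γT, hγT, -, hT⟩ := Summit.QuantumFields.YangMills.Theorems.LogComparisonAlphaAdapter.exists_gamma_thresholds
    (B₃ := 𝔠.B₃) 𝔠.b₀_pos 𝔠.p₀_pos ha1 𝔠.B₃_pos.le h0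
  have hg0 : 0 < (min 𝔠.gamma0 1) ^ 2 := pow_pos (lt_min 𝔠.gamma0_pos one_pos) 2
  obtain ⟨γs, hγs, hS'⟩ := hm₀ m ((le_max_left _ _).trans hm) 𝔠.b₀ 𝔠.p₀ hb hp
  refine ⟨min (min γB (min γT ((min 𝔠.gamma0 1) ^ 2))) γs,
    lt_min (lt_min hγB (lt_min hγT hg0)) hγs, fun F γ hF hγ hγ₁ => ?_⟩
  subst hF
  have hγB' : γ ≤ γB := hγ₁.trans ((min_le_left _ _).trans (min_le_left _ _))
  have hγT' : γ ≤ γT := hγ₁.trans ((min_le_left _ _).trans ((min_le_right _ _).trans (min_le_left _ _)))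
  have hγ1 : γ ≤ (min 𝔠.gamma0 1) ^ 2 := hγ₁.trans ((min_le_left _ _).trans ((min_le_right _ _).trans (min_le_right _ _)))
  have hγs' : γ ≤ γs := hγ₁.trans (min_le_right _ _)
  obtain ⟨p, hp, π, σ, C, hσ, hC0, hG⟩ := hBC F γ rfl hγ hγB' hγ1 (h𝔠 F rfl)
  obtain ⟨hT1, hT2, hT3⟩ := hT F.L F.hL.2.le γ hγ hγT'
  have hRep := Summit.QuantumFields.YangMills.Theorems.AlphaInputsT3AC.repAtHeights_dataOfV3 p π hp ε₀ h0 h1a hT1 hT2 hT3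
  have hrepOn : TwoSidedRepOn F γ 𝔠.b₀ 𝔠.p₀ (fun K n h V => ChiGood F γ 𝔠.b₀ 𝔠.p₀ ε₀ (μ F.L) (n := n) (K := K) h V) ε₀
      (Summit.QuantumFields.YangMills.Theorems.AlphaInputsT3AC.dataOfV3 p π).PintH
      (Summit.QuantumFields.YangMills.Theorems.AlphaInputsT3AC.dataOfV3 p π).EcstH
      (Summit.QuantumFields.YangMills.Theorems.AlphaInputsT3AC.dataOfV3 p π).RmH :=
    twoSidedRepOn_of_repAt _ hRep
  have hCau := hS' F γ rfl hγ hγs' (fun K n h V => ChiGood F γ 𝔠.b₀ 𝔠.p₀ ε₀ (μ F.L) (n := n) (K := K) h V)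
    (Summit.QuantumFields.YangMills.Theorems.AlphaInputsT3AC.dataOfV3 p π) σ C hσ hC0 (hG ε₀ h0 h1a)
  obtain ⟨r, κ, hr, hr0, hC⟩ := stubBodyOn_of_repOn_of_cauchyOn F γ 𝔠.b₀ 𝔠.p₀ ε₀ hmpos _ _ _ _ hrepOn hCau
  refine ⟨r, κ, hr, hr0, fun K => ?_⟩
  filter_upwards [hC K] with V hV
  intro hs hχ hχ' h0' h0''
  exact hV hs hχ hχ' h0' h0''

end Composition

/-! ## §4 The owner's socket (b2): (i)* [K1a on χ, EVERY margin] → (ii)* [edge off χ, SOME margin] → 4′ verbatim (RULING g21-№4 §A) -/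

section OwnerSocket

/-- **`fourPrime_of_slackOnChi_edge` — THE SOCKET OF RULING g21-№4 §A (b2).**  (2′) the registered lane-records stub verbatim; (i)* the inner piece in 3⁗'s INPUT currency
read on χ-good data FOR EVERY MARGIN `μ ∈ (0,1)` (binders as 3⁗ with `7 ≤ L` replaced by `1 < L → L < 7 → ∀ μ, 0 < μ → μ < 1 →`; the row `GlobalSupRateTSlackOn χ_{ε₀,μ}` is asserted
for every `0 < ε₀ ≤ a₀` AFTER `p, π, σ, C` are chosen — `ChiGood` depends on `ε₀` through print's regular space, the charts do not); (ii)* the edge-oscillation clause off the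
doubly-χ-good set FOR SOME MARGIN (`∃ μ, 0 < μ ∧ μ < 1 ∧ …` right after `L < 7 →`).  Conclusion: THE REGISTERED 4′ TEXT — §3 at the choice function `L ↦ μ(L)` read off (ii)*.
NOT sanctioned and not used: (ii) with `∀ μ`, a fixed numeral, or one stub `∃ μ, (i)(μ) ∧ (ii)(μ)` (RULING g21-№1 §2(c)). [cite: King1986, Thm 3.4 (3.9) p.656; Balaban1985UV3, (47) p.267] -/
theorem fourPrime_of_slackOnChi_edge
    (h2 : ∀ L : ℕ, Odd L → 1 < L → Summit.QuantumFields.YangMills.Theorems.AlphaInputsT3ACv3Rec L)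
    (hI : ∀ (L : ℕ), Odd L → 1 < L → L < 7 → ∀ (μ : ℝ), 0 < μ → μ < 1 →
      ∀ (𝔠 : Summit.QuantumFields.Balaban3D.Proofs.Primitives.AlphaConsts L (Summit.QuantumFields.Balaban3D.Carriers.suGroupModel 2).N)
        (a₀ a₁ : ℝ), 0 < a₀ → 0 < a₁ → 𝔠.B₃ * a₁ ≤ a₀ →
        ∃ a : ℝ, 0 < a ∧ ∃ γB : ℝ, 0 < γB ∧ ∀ (F : T3Family) (γ : ℝ) (hF : F.L = L) (hγ : 0 < γ), γ ≤ γB →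
          ∀ (hγ1 : γ ≤ (min (hF ▸ 𝔠).gamma0 1) ^ 2),
            Summit.QuantumFields.YangMills.Theorems.AlphaInputsT3AC.OfV3At F (hF ▸ 𝔠) a₀ a₁ →
            ∃ (p : ∀ K, Summit.QuantumFields.YangMills.Theorems.AlphaInputsT3AC.PkgAtV3 F (hF ▸ 𝔠) γ hγ hγ1 K),
              (∀ K, (p K).a₀ = a₀ ∧ (p K).a₁ = a₁) ∧
              ∃ (π : Summit.QuantumFields.YangMills.Theorems.AlphaInputsT3AC.PolymerT3 F) (σ : ℕ) (C : ℝ), 7 ≤ σ ∧ 0 ≤ C ∧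
                ∀ ε₀ : ℝ, 0 < ε₀ → ε₀ ≤ a₀ →
                  GlobalSupRateTSlackOn (fun K n h V => ChiGood F γ (hF ▸ 𝔠).b₀ (hF ▸ 𝔠).p₀ ε₀ μ (n := n) (K := K) h V)
                    (Summit.QuantumFields.YangMills.Theorems.AlphaInputsT3AC.dataOfV3 p π) (hF ▸ 𝔠).b₀ (hF ▸ 𝔠).p₀ a σ C)
    (hII : ∀ (L : ℕ), Odd L → 1 < L → L < 7 → ∃ μ : ℝ, 0 < μ ∧ μ < 1 ∧ ∃ (b₁ p₁ : ℝ), ∀ (b₀ p₀ : ℝ), b₁ ≤ b₀ → p₁ ≤ p₀ → 0 < b₀ → 2 < p₀ →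
      ∃ ε₁ : ℝ, 0 < ε₁ ∧ ∀ (ε₀ : ℝ), 0 < ε₀ → ε₀ ≤ ε₁ → ∃ m₀ : ℕ, ∀ (m : ℕ), m₀ ≤ m →
        ∃ γ₁ : ℝ, 0 < γ₁ ∧ ∀ (F : T3Family) (γ : ℝ), F.L = L → 0 < γ → γ ≤ γ₁ →
          ∃ r' : ℕ → ℝ, Summable r' ∧ (∀ K, 0 ≤ r' K) ∧ ∀ K, ∃ c : ℝ,
            (∀ᵐ V ∂fieldMeasure (F.P (K / m)) 0 (Matrix.specialUnitaryGroup (Fin 2) ℂ),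
              PlaqSmall (θBal F.L γ b₀ p₀ (K / m)) V →
                ¬ (ChiGood F γ b₀ p₀ ε₀ μ (Nat.div_le_self K m) V ∧
                    ChiGood F γ b₀ p₀ ε₀ μ ((Nat.div_le_self K m).trans (Nat.le_succ K)) V) →
                0 < heightDensity F γ (Nat.div_le_self K m) (histGood F ℰp (θBal F.L γ b₀ p₀) K (K / m)) V →
                0 < heightDensity F γ ((Nat.div_le_self K m).trans (Nat.le_succ K))
                      (histGood F ℰp (θBal F.L γ b₀ p₀) (K + 1) (K / m)) V →
                  |(Real.log (heightDensity F γ ((Nat.div_le_self K m).trans (Nat.le_succ K))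
                        (histGood F ℰp (θBal F.L γ b₀ p₀) (K + 1) (K / m)) V) + bgRegPr' F γ m ε₀ K V) -
                    (Real.log (heightDensity F γ (Nat.div_le_self K m) (histGood F ℰp (θBal F.L γ b₀ p₀) K (K / m)) V) + bgRegPr F γ m ε₀ K V) -
                      c| ≤ r' K) ∧
            (∃ᵐ V ∂fieldMeasure (F.P (K / m)) 0 (Matrix.specialUnitaryGroup (Fin 2) ℂ),
              (PlaqSmall (θBal F.L γ b₀ p₀ (K / m)) V ∧
                ChiGood F γ b₀ p₀ ε₀ μ (Nat.div_le_self K m) V ∧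
                ChiGood F γ b₀ p₀ ε₀ μ ((Nat.div_le_self K m).trans (Nat.le_succ K)) V) ∧
                0 < heightDensity F γ (Nat.div_le_self K m) (histGood F ℰp (θBal F.L γ b₀ p₀) K (K / m)) V ∧
                0 < heightDensity F γ ((Nat.div_le_self K m).trans (Nat.le_succ K))
                      (histGood F ℰp (θBal F.L γ b₀ p₀) (K + 1) (K / m)) V ∧
                  |(Real.log (heightDensity F γ ((Nat.div_le_self K m).trans (Nat.le_succ K))
                        (histGood F ℰp (θBal F.L γ b₀ p₀) (K + 1) (K / m)) V) + bgRegPr' F γ m ε₀ K V) -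
                    (Real.log (heightDensity F γ (Nat.div_le_self K m) (histGood F ℰp (θBal F.L γ b₀ p₀) K (K / m)) V) + bgRegPr F γ m ε₀ K V) -
                      c| ≤ r' K)) :
    ∀ (L : ℕ), Odd L → 1 < L → L < 7 → ∃ (b₁ p₁ : ℝ), ∀ (b₀ p₀ : ℝ), b₁ ≤ b₀ → p₁ ≤ p₀ → 0 < b₀ → 2 < p₀ →
      ∃ ε₁ : ℝ, 0 < ε₁ ∧ ∀ (ε₀ : ℝ), 0 < ε₀ → ε₀ ≤ ε₁ → ∃ m₀ : ℕ, ∀ (m : ℕ), m₀ ≤ m →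
        ∃ γ₁ : ℝ, 0 < γ₁ ∧ ∀ (F : T3Family) (γ : ℝ), F.L = L → 0 < γ → γ ≤ γ₁ →
          ∃ (r κ : ℕ → ℝ), Summable r ∧ (∀ K, 0 ≤ r K) ∧
            ∀ K, ∀ᵐ V ∂fieldMeasure (F.P (K / m)) 0 (Matrix.specialUnitaryGroup (Fin 2) ℂ),
              PlaqSmall (θBal F.L γ b₀ p₀ (K / m)) V →
                0 < heightDensity F γ (Nat.div_le_self K m) (histGood F ℰp (θBal F.L γ b₀ p₀) K (K / m)) V →
                0 < heightDensity F γ ((Nat.div_le_self K m).trans (Nat.le_succ K))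
                      (histGood F ℰp (θBal F.L γ b₀ p₀) (K + 1) (K / m)) V →
                  |(Real.log (heightDensity F γ ((Nat.div_le_self K m).trans (Nat.le_succ K))
                        (histGood F ℰp (θBal F.L γ b₀ p₀) (K + 1) (K / m)) V) + bgRegPr' F γ m ε₀ K V) -
                    (Real.log (heightDensity F γ (Nat.div_le_self K m) (histGood F ℰp (θBal F.L γ b₀ p₀) K (K / m)) V) + bgRegPr F γ m ε₀ K V) -
                      κ K| ≤ r K := by
  classical
  -- the margin selected per block size from (ii)*
  let μf : ℕ → ℝ := fun L => if h : Odd L ∧ 1 < L ∧ L < 7 then Classical.choose (hII L h.1 h.2.1 h.2.2) else 1 / 2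
  have hμf : ∀ (L : ℕ) (hO : Odd L) (h1 : 1 < L) (h7 : L < 7), μf L = Classical.choose (hII L hO h1 h7) := fun L hO h1 h7 => by
    show (if h : Odd L ∧ 1 < L ∧ L < 7 then Classical.choose (hII L h.1 h.2.1 h.2.2) else 1 / 2) = _
    rw [dif_pos ⟨hO, h1, h7⟩]
  refine stub_logComparisonSmallBlocks_of_laneRecords_slackOnChi_edge μf h2 (fun L hO h1 h7 => ?_) (fun L hO h1 h7 => ?_)
  · have hs := Classical.choose_spec (hII L hO h1 h7)
    rw [hμf L hO h1 h7]
    exact hI L hO h1 h7 _ hs.1 hs.2.1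
  · have hs := Classical.choose_spec (hII L hO h1 h7)
    rw [hμf L hO h1 h7]
    exact hs.2.2

end OwnerSocket


end Summit.QuantumFields.YangMills.Theorems.PrintChi

end
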